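import Mathlib
import HarnessLib
import Summits.AtomisticToContinuum.Crystallization.Theorems.PricedLinkCensusSoftFourRingsCapTypeOCell
import Summits.AtomisticToContinuum.Crystallization.Theorems.PricedLinkCensusSoftFourRingsCapTypeData
import Summits.AtomisticToContinuum.Crystallization.Theorems.PricedLinkCensusSoftFourRingsTypePairs
import Summits.AtomisticToContinuum.Crystallization.Theorems.PricedLinkCensusSoftFourRingsCapApex
import Summits.AtomisticToContinuum.Crystallization.Theorems.PricedLinkCensusSoftFourRingsCube1

/-!
# Soft four-rings, endgame: type-O bookkeeping for the cuboctahedral branch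

Support file for `SoftFourRings` (route `PricedLinkCensus`, sub-problem `Crystallization`),
endgame step (E5) of the evidence file (§12.8), point-level form.  Type-O data `(a, b, c, d)`
at `u` means `N(u) = {a, b, c, d}`, `a ∼ b`, `c ∼ d`, and the four cross pairs are non-bonds.

* `typeO_swap_pairs`, `typeO_swap12` — symmetries of type-O data;
* `typeO_complete` — type-O data is recovered from one bonded pair and one further neighbour;
* `alpha_of_typeO` — if the end `a` of the bonded pair `{a, b}` is itself of type O, then
  `{a, b}` has no common neighbour other than `u` (the hypothesis `hα` of the cell lemma);
* `typeO_cells` — point form of `typeO_common_neighbours`: `a` has a common bond `x ∉ N[u]`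
  with one of `c, d`, and `b` with the other.

**`Cap` variant** (seat c3 of stmt-AtomisticToContinuum-14234): identical to `PricedLinkCensusSoftFourRingsCube1`, except that the
global Tammes-13 hypothesis `(hT : musinTarasov2012_tammes_thirteen)` is replaced by the LOCAL covering
property of the twelve directions, `hT : ∀ p, ‖p‖ = 1 → ∃ x ∈ X, dist p x < 0.957` (no empty cap of
angular radius `57.18°`), which is all the two roots (`FacetCap`, `Interior`) ever used; the hT-free
lemmas are not repeated (the original file is imported for them).
-/

namespace Summit.AtomisticToContinuum.Crystallization.Theorems.Cap

open Real RealInnerProductSpace Literature.Geometry.DiscreteGeometry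

section Pairs

end Pairs

section Setting

open scoped Classical in
/-- **The cells at a type-O vertex, point form**: with type-O data `(a, b, c, d)` at `u` and no
common neighbour of `a, b` other than `u`, the point `a` has a common bond `x ∉ N[u]` with one of
`c, d` and `b` a common bond `y ∉ N[u]` with the other. -/
theorem typeO_cells
    {X : Finset (EuclideanSpace ℝ (Fin 3))}
    {B : Finset (Finset (EuclideanSpace ℝ (Fin 3)))}
    (hT : ∀ p : EuclideanSpace ℝ (Fin 3), ‖p‖ = 1 → ∃ x ∈ X, dist p x < 0.957)
    (hX1 : ∀ y ∈ X, ‖y‖ = 1)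
    (hcard : X.card = 12)
    (hsepX : ∀ u ∈ X, ∀ u' ∈ X, u ≠ u' → ⟪u, u'⟫ ≤ 1 - 1 / (2 * (101 / 100 : ℝ) ^ 2))
    (hB : ∀ T ∈ B, ∃ u ∈ X, ∃ u' ∈ X, u ≠ u' ∧ 1 - (101 / 100 : ℝ) ^ 2 / 2 ≤ ⟪u, u'⟫ ∧ T = {u, u'})
    (hBcard : B.card = 24)
    (hdeg : ∀ v ∈ X, ∃ w : Fin 4 → EuclideanSpace ℝ (Fin 3), (∀ k, w k ∈ X) ∧ Function.Injective w ∧ (∀ k, w k ≠ v) ∧ (∀ k, ({v, w k} : Finset (EuclideanSpace ℝ (Fin 3))) ∈ B) ∧ ∀ y, ({v, y} : Finset (EuclideanSpace ℝ (Fin 3))) ∈ B → ∃ k, y = w k) {u a b c d : EuclideanSpace ℝ (Fin 3)} (hu : u ∈ X)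
    (hN : ∀ y, ({u, y} : Finset (EuclideanSpace ℝ (Fin 3))) ∈ B ↔ (y = a ∨ y = b ∨ y = c ∨ y = d))
    (hd : a ≠ b ∧ a ≠ c ∧ a ≠ d ∧ b ≠ c ∧ b ≠ d ∧ c ≠ d)
    (hab : ({a, b} : Finset (EuclideanSpace ℝ (Fin 3))) ∈ B) (hcd : ({c, d} : Finset (EuclideanSpace ℝ (Fin 3))) ∈ B)
    (hac : ({a, c} : Finset (EuclideanSpace ℝ (Fin 3))) ∉ B) (had : ({a, d} : Finset (EuclideanSpace ℝ (Fin 3))) ∉ B)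
    (hbc : ({b, c} : Finset (EuclideanSpace ℝ (Fin 3))) ∉ B) (hbd : ({b, d} : Finset (EuclideanSpace ℝ (Fin 3))) ∉ B)
    (hα : ∀ z, ({z, a} : Finset (EuclideanSpace ℝ (Fin 3))) ∈ B → ({z, b} : Finset (EuclideanSpace ℝ (Fin 3))) ∈ B → z = u) :
    ((∃ x ∈ X, x ≠ u ∧ x ≠ a ∧ x ≠ b ∧ x ≠ c ∧ x ≠ d ∧
        ({x, a} : Finset (EuclideanSpace ℝ (Fin 3))) ∈ B ∧ ({x, c} : Finset (EuclideanSpace ℝ (Fin 3))) ∈ B) ∧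
      (∃ y ∈ X, y ≠ u ∧ y ≠ a ∧ y ≠ b ∧ y ≠ c ∧ y ≠ d ∧
        ({y, b} : Finset (EuclideanSpace ℝ (Fin 3))) ∈ B ∧ ({y, d} : Finset (EuclideanSpace ℝ (Fin 3))) ∈ B)) ∨
    ((∃ x ∈ X, x ≠ u ∧ x ≠ a ∧ x ≠ b ∧ x ≠ c ∧ x ≠ d ∧
        ({x, a} : Finset (EuclideanSpace ℝ (Fin 3))) ∈ B ∧ ({x, d} : Finset (EuclideanSpace ℝ (Fin 3))) ∈ B) ∧
      (∃ y ∈ X, y ≠ u ∧ y ≠ a ∧ y ≠ b ∧ y ≠ c ∧ y ≠ d ∧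
        ({y, b} : Finset (EuclideanSpace ℝ (Fin 3))) ∈ B ∧ ({y, c} : Finset (EuclideanSpace ℝ (Fin 3))) ∈ B)) := by
  obtain ⟨hab', hac', had', hbc', hbd', hcd'⟩ := hd
  set w : Fin 4 → EuclideanSpace ℝ (Fin 3) := ![a, b, c, d] with hw
  have hwinj : Function.Injective w := injective_vec4 hab' hac' had' hbc' hbd' hcd'
  have hvw : ∀ k, ({u, w k} : Finset (EuclideanSpace ℝ (Fin 3))) ∈ B := by
    intro k
    fin_cases k
    · exact (hN a).2 (Or.inl rfl)
    · exact (hN b).2 (Or.inr (Or.inl rfl))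
    · exact (hN c).2 (Or.inr (Or.inr (Or.inl rfl)))
    · exact (hN d).2 (Or.inr (Or.inr (Or.inr rfl)))
  have hwX : ∀ k, w k ∈ X := fun k => (mem_of_mem_bonds hB (hvw k)).2
  have hwv : ∀ k, w k ≠ u := fun k => (ne_of_mem_bonds hB (hvw k)).symm
  have hvonly : ∀ y, ({u, y} : Finset (EuclideanSpace ℝ (Fin 3))) ∈ B → ∃ k, y = w k := by
    intro y hy
    rw [exists_fin_four_iff]
    exact (hN y).1 hy
  have hnd : [(0 : Fin 4), 1, 2, 3].Nodup := by decide
  have hBij : ({w 0, w 1} : Finset (EuclideanSpace ℝ (Fin 3))) ∈ B := hab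
  have hBkl : ({w 2, w 3} : Finset (EuclideanSpace ℝ (Fin 3))) ∈ B := hcd
  have hNB : ∀ p q : Fin 4, p ≠ q → ({w p, w q} : Finset (EuclideanSpace ℝ (Fin 3))) ∈ B →
      ({p, q} : Finset (Fin 4)) = {0, 1} ∨ ({p, q} : Finset (Fin 4)) = {2, 3} := by
    intro p q _ hBpq
    fin_cases p <;> fin_cases q
    all_goals
      simp only [hw, Fin.zero_eta, Fin.mk_one, Fin.isValue, Fin.reduceFinMk,
        Matrix.cons_val_zero, Matrix.cons_val_one, Matrix.cons_val] at hBpq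
    all_goals first
      | (left; decide)
      | (right; decide)
      | (exfalso; exact (ne_of_mem_bonds hB hBpq) rfl)
      | (exfalso; exact hac hBpq)
      | (exfalso; exact had hBpq)
      | (exfalso; exact hbc hBpq)
      | (exfalso; exact hbd hBpq)
      | (exfalso; rw [Finset.pair_comm] at hBpq; exact hac hBpq)
      | (exfalso; rw [Finset.pair_comm] at hBpq; exact had hBpq)
      | (exfalso; rw [Finset.pair_comm] at hBpq; exact hbc hBpq)
      | (exfalso; rw [Finset.pair_comm] at hBpq; exact hbd hBpq)
  have hα' : ∀ z, ({z, w 0} : Finset (EuclideanSpace ℝ (Fin 3))) ∈ B → ({z, w 1} : Finset (EuclideanSpace ℝ (Fin 3))) ∈ B → z = u := hα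
  rcases typeO_common_neighbours hT hX1 hcard hsepX hB hBcard hdeg hu w hwX hwinj hwv hvw hvonly hnd
      hNB hα' (i := 0) (j := 1) (k := 2) (l := 3) hBij hBkl with
    ⟨⟨x, hxX, hxu, hxw, hB1, hB2⟩, ⟨y, hyX, hyu, hyw, hB3, hB4⟩⟩ |
    ⟨⟨x, hxX, hxu, hxw, hB1, hB2⟩, ⟨y, hyX, hyu, hyw, hB3, hB4⟩⟩
  · exact Or.inl ⟨⟨x, hxX, hxu, hxw 0, hxw 1, hxw 2, hxw 3, hB1, hB2⟩,
      ⟨y, hyX, hyu, hyw 0, hyw 1, hyw 2, hyw 3, hB3, hB4⟩⟩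
  · exact Or.inr ⟨⟨x, hxX, hxu, hxw 0, hxw 1, hxw 2, hxw 3, hB1, hB2⟩,
      ⟨y, hyX, hyu, hyw 0, hyw 1, hyw 2, hyw 3, hB3, hB4⟩⟩

end Setting

end Summit.AtomisticToContinuum.Crystallization.Theorems.Cap
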